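import Literature.MathematicalPhysics.QuantumLattice.KohnLuttingerFermiCurvePolar
import HarnessLib

/-!
# Integration against the Fermi-curve measure in polar coordinates

Topic `Literature/MathematicalPhysics/QuantumLattice`; the working form of
`KohnLuttingerFermiCurvePolar.fermiCurveMeasure_eq_map` (`μ_F = γ_* (w dθ ⌞ (-π, π])`,
`γ = fermiPolar μ`, `w = fermiPolarDOS μ`, `ε = squareDispersion 1 0`, `-4 < μ < 0`):

* `fermiPolarDOS_add_two_pi` — the density of states is `2π`-periodic in the angle;
  `exists_bounds_fermiPolarDOS` — `0 < w₀ ≤ w(θ) ≤ w₁` uniformly in `θ`;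
* `lintegral_fermiCurveMeasure` — `∫⁻ g dμ_F = ∫⁻_{(-π,π]} g(γ θ) · w(θ) dθ` (`g` measurable);
* `fermiCurveMeasure_univ_lt_top`, `isFiniteMeasure_fermiCurveMeasure`, `fermiCurveMeasure_univ_pos` —
  `μ_F` is a finite non-zero measure;
* `integral_fermiCurveMeasure` — `∫ f dμ_F = ∫_{(-π,π]} w(θ) f(γ θ) dθ` and
  `integrable_fermiCurveMeasure_iff` (for `f` a.e.-strongly measurable).

Everything is proved; no definitions. [folklore]
-/

noncomputable section

open Real Set Filter MeasureTheory MeasureTheory.Measure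
open scoped Topology ENNReal NNReal

namespace Literature.MathematicalPhysics.QuantumLattice

/-! ### Periodicity and two-sided bounds of the density of states -/

section Periodic

variable {μ : ℝ} (hμ₁ : -4 < μ) (hμ₂ : μ < 0)
include hμ₁ hμ₂

/-- `u'_μ(θ + 2π) = u'_μ(θ)`. [folklore] -/
theorem bandFermiRadiusDeriv_add_two_pi (θ : ℝ) :
    bandFermiRadiusDeriv μ (θ + 2 * π) = bandFermiRadiusDeriv μ θ := by
  unfold bandFermiRadiusDeriv rayDispersionDθ rayDispersionDt
  rw [bandFermiRadius_add_two_pi hμ₁ hμ₂, Real.cos_add_two_pi, Real.sin_add_two_pi]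

/-- `γ'(θ + 2π) = γ'(θ)`. [folklore] -/
theorem fermiPolarVelocity_add_two_pi (θ : ℝ) :
    fermiPolarVelocity μ (θ + 2 * π) = fermiPolarVelocity μ θ := by
  unfold fermiPolarVelocity
  rw [bandFermiRadiusDeriv_add_two_pi hμ₁ hμ₂, bandFermiRadius_add_two_pi hμ₁ hμ₂, Real.cos_add_two_pi,
    Real.sin_add_two_pi]
  congr 2
  ext i; fin_cases i <;> simp [dir, Real.cos_add_two_pi, Real.sin_add_two_pi]

/-- **The density of states is `2π`-periodic.** [folklore] -/
theorem fermiPolarDOS_add_two_pi (θ : ℝ) : fermiPolarDOS μ (θ + 2 * π) = fermiPolarDOS μ θ := by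
  unfold fermiPolarDOS
  rw [fermiPolarVelocity_add_two_pi hμ₁ hμ₂, fermiPolar_add_two_pi hμ₁ hμ₂]

/-- The density of states as a function on the circle `ℝ/2πℤ`: `w(θ + 2kπ) = w(θ)`. [folklore] -/
theorem fermiPolarDOS_add_int_mul_two_pi (θ : ℝ) (k : ℤ) :
    fermiPolarDOS μ (θ + k * (2 * π)) = fermiPolarDOS μ θ := by
  have hper : Function.Periodic (fermiPolarDOS μ) (2 * π) := fun θ => fermiPolarDOS_add_two_pi hμ₁ hμ₂ θ
  exact hper.int_mul k θ

/-- **Two-sided bounds**: `0 < w₀ ≤ fermiPolarDOS μ θ ≤ w₁` for all `θ` (continuity on the period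
`[-π, π]`, periodicity). [folklore] -/
theorem exists_bounds_fermiPolarDOS :
    ∃ w₀ w₁ : ℝ, 0 < w₀ ∧ ∀ θ, w₀ ≤ fermiPolarDOS μ θ ∧ fermiPolarDOS μ θ ≤ w₁ := by
  have hc := continuous_fermiPolarDOS hμ₁ hμ₂
  have hK : IsCompact (Icc (-π) π) := isCompact_Icc
  have hne : (Icc (-π) π).Nonempty := ⟨0, by constructor <;> linarith [Real.pi_pos]⟩
  obtain ⟨θ₀, hθ₀, hmin⟩ := hK.exists_isMinOn hne hc.continuousOn
  obtain ⟨θ₁, hθ₁, hmax⟩ := hK.exists_isMaxOn hne hc.continuousOn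
  refine ⟨fermiPolarDOS μ θ₀, fermiPolarDOS μ θ₁, fermiPolarDOS_pos hμ₁ hμ₂ θ₀, fun θ => ?_⟩
  -- reduce `θ` to the period `(-π, π]`
  set θ' := toIocMod Real.two_pi_pos (-π) θ with hθ'
  have hmem : θ' ∈ Icc (-π) π := by
    have h := toIocMod_mem_Ioc Real.two_pi_pos (-π) θ
    rw [← hθ'] at h
    exact ⟨h.1.le, by linarith [h.2]⟩
  have heq : fermiPolarDOS μ θ = fermiPolarDOS μ θ' := by
    have : θ' = θ + (-(toIocDiv Real.two_pi_pos (-π) θ) : ℤ) * (2 * π) := by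
      rw [hθ', toIocMod, zsmul_eq_mul]; push_cast; ring
    rw [this, fermiPolarDOS_add_int_mul_two_pi hμ₁ hμ₂]
  rw [heq]
  exact ⟨hmin hmem, hmax hmem⟩

end Periodic

/-! ### Integrals against the Fermi-curve measure -/

section Integral

variable {μ : ℝ} (hμ₁ : -4 < μ) (hμ₂ : μ < 0)
include hμ₁ hμ₂

/-- The density as an `ℝ≥0`-valued measurable function. [folklore] -/
theorem measurable_fermiPolarDOS_toNNReal : Measurable fun θ : ℝ => (fermiPolarDOS μ θ).toNNReal :=
  (continuous_fermiPolarDOS hμ₁ hμ₂).measurable.real_toNNReal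

/-- `μ_F = γ_* (w dθ ⌞ (-π,π])` with the density spelled as an `ℝ≥0`-coercion. [folklore] -/
theorem fermiCurveMeasure_eq_map_toNNReal :
    fermiCurveMeasure (squareDispersion 1 0) μ =
      Measure.map (fermiPolar μ) ((volume.restrict (Ioc (-π) π)).withDensity fun θ =>
        ((fermiPolarDOS μ θ).toNNReal : ℝ≥0∞)) :=
  fermiCurveMeasure_eq_map hμ₁ hμ₂

/-- **`∫⁻ g dμ_F = ∫⁻_{(-π,π]} g(γ θ) · w(θ) dθ`** for measurable `g ≥ 0`. [folklore] -/
theorem lintegral_fermiCurveMeasure {g : Momentum → ℝ≥0∞} (hg : Measurable g) :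
    ∫⁻ k, g k ∂fermiCurveMeasure (squareDispersion 1 0) μ =
      ∫⁻ θ in Ioc (-π) π, g (fermiPolar μ θ) * ENNReal.ofReal (fermiPolarDOS μ θ) := by
  have hFm : Measurable (fermiPolar μ) := (continuous_fermiPolar hμ₁ hμ₂).measurable
  have hρ : Measurable fun θ : ℝ => ENNReal.ofReal (fermiPolarDOS μ θ) :=
    ENNReal.measurable_ofReal.comp (continuous_fermiPolarDOS hμ₁ hμ₂).measurable
  rw [fermiCurveMeasure_eq_map hμ₁ hμ₂, lintegral_map hg hFm,
    lintegral_withDensity_eq_lintegral_mul _ hρ (show Measurable fun a => g (fermiPolar μ a) from hg.comp hFm)]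
  refine lintegral_congr fun θ => ?_
  simp only [Pi.mul_apply]
  ring

/-- The total mass of the Fermi-curve measure: `μ_F(ℝ²) = ∫_{(-π,π]} w`. [folklore] -/
theorem fermiCurveMeasure_univ :
    fermiCurveMeasure (squareDispersion 1 0) μ univ =
      ∫⁻ θ in Ioc (-π) π, ENNReal.ofReal (fermiPolarDOS μ θ) := by
  have h := lintegral_fermiCurveMeasure hμ₁ hμ₂ (g := fun _ => 1) measurable_const
  simp only [one_mul, lintegral_one] at h
  exact h

/-- **The Fermi-curve measure is finite.** [folklore] -/
theorem fermiCurveMeasure_univ_lt_top : fermiCurveMeasure (squareDispersion 1 0) μ univ < ⊤ := by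
  obtain ⟨w₀, w₁, hw₀, hw⟩ := exists_bounds_fermiPolarDOS hμ₁ hμ₂
  rw [fermiCurveMeasure_univ hμ₁ hμ₂]
  calc ∫⁻ θ in Ioc (-π) π, ENNReal.ofReal (fermiPolarDOS μ θ)
      ≤ ∫⁻ _ in Ioc (-π) π, ENNReal.ofReal w₁ :=
        lintegral_mono fun θ => ENNReal.ofReal_le_ofReal (hw θ).2
    _ < ⊤ := by
        rw [setLIntegral_const]
        exact ENNReal.mul_lt_top ENNReal.ofReal_lt_top (by rw [Real.volume_Ioc]; exact ENNReal.ofReal_lt_top)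

/-- The Fermi-curve measure is a finite measure. [folklore] -/
theorem isFiniteMeasure_fermiCurveMeasure : IsFiniteMeasure (fermiCurveMeasure (squareDispersion 1 0) μ) :=
  ⟨fermiCurveMeasure_univ_lt_top hμ₁ hμ₂⟩

/-- **The Fermi-curve measure is non-zero**: `μ_F(ℝ²) ≥ 2π w₀ > 0`. [folklore] -/
theorem fermiCurveMeasure_univ_pos : 0 < fermiCurveMeasure (squareDispersion 1 0) μ univ := by
  obtain ⟨w₀, w₁, hw₀, hw⟩ := exists_bounds_fermiPolarDOS hμ₁ hμ₂
  rw [fermiCurveMeasure_univ hμ₁ hμ₂]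
  calc (0 : ℝ≥0∞) < ∫⁻ _ in Ioc (-π) π, ENNReal.ofReal w₀ := by
        rw [setLIntegral_const, Real.volume_Ioc]
        refine ENNReal.mul_pos (ENNReal.ofReal_pos.2 hw₀).ne' (ENNReal.ofReal_pos.2 ?_).ne'
        linarith [Real.pi_pos]
    _ ≤ ∫⁻ θ in Ioc (-π) π, ENNReal.ofReal (fermiPolarDOS μ θ) :=
        lintegral_mono fun θ => ENNReal.ofReal_le_ofReal (hw θ).1

/-- **`∫ f dμ_F = ∫_{(-π,π]} w(θ) f(γ θ) dθ`** for every `f` that is a.e.-strongly measurable for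
`μ_F` (Bochner integrals; both sides are `0` together when `f` is not integrable). [folklore] -/
theorem integral_fermiCurveMeasure {f : Momentum → ℝ}
    (hf : AEStronglyMeasurable f (fermiCurveMeasure (squareDispersion 1 0) μ)) :
    ∫ k, f k ∂fermiCurveMeasure (squareDispersion 1 0) μ =
      ∫ θ in Ioc (-π) π, fermiPolarDOS μ θ * f (fermiPolar μ θ) := by
  have hFm : AEMeasurable (fermiPolar μ) ((volume.restrict (Ioc (-π) π)).withDensity fun θ =>
      ((fermiPolarDOS μ θ).toNNReal : ℝ≥0∞)) := (continuous_fermiPolar hμ₁ hμ₂).measurable.aemeasurable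
  rw [fermiCurveMeasure_eq_map_toNNReal hμ₁ hμ₂] at hf ⊢
  rw [integral_map hFm hf, integral_withDensity_eq_integral_smul (measurable_fermiPolarDOS_toNNReal hμ₁ hμ₂)]
  refine integral_congr_ae (Filter.Eventually.of_forall fun θ => ?_)
  dsimp only
  rw [NNReal.smul_def, smul_eq_mul, Real.coe_toNNReal _ (fermiPolarDOS_pos hμ₁ hμ₂ θ).le]

/-- **Integrability against `μ_F` in polar coordinates.** [folklore] -/
theorem integrable_fermiCurveMeasure_iff {f : Momentum → ℝ}
    (hf : AEStronglyMeasurable f (fermiCurveMeasure (squareDispersion 1 0) μ)) :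
    Integrable f (fermiCurveMeasure (squareDispersion 1 0) μ) ↔
      Integrable (fun θ => fermiPolarDOS μ θ * f (fermiPolar μ θ)) (volume.restrict (Ioc (-π) π)) := by
  have hFm : AEMeasurable (fermiPolar μ) ((volume.restrict (Ioc (-π) π)).withDensity fun θ =>
      ((fermiPolarDOS μ θ).toNNReal : ℝ≥0∞)) := (continuous_fermiPolar hμ₁ hμ₂).measurable.aemeasurable
  rw [fermiCurveMeasure_eq_map_toNNReal hμ₁ hμ₂] at hf ⊢
  rw [integrable_map_measure hf hFm,
    integrable_withDensity_iff_integrable_smul (measurable_fermiPolarDOS_toNNReal hμ₁ hμ₂)]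
  refine integrable_congr (Filter.Eventually.of_forall fun θ => ?_)
  dsimp only [Function.comp_apply]
  rw [NNReal.smul_def, smul_eq_mul, Real.coe_toNNReal _ (fermiPolarDOS_pos hμ₁ hμ₂ θ).le]

/-- A function a.e.-strongly measurable for `μ_F` pulls back to one on the parameter interval.
[folklore] -/
theorem aestronglyMeasurable_comp_fermiPolar {f : Momentum → ℝ}
    (hf : AEStronglyMeasurable f (fermiCurveMeasure (squareDispersion 1 0) μ)) :
    AEStronglyMeasurable (fun θ => f (fermiPolar μ θ)) (volume.restrict (Ioc (-π) π)) := by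
  have hFm : AEMeasurable (fermiPolar μ) ((volume.restrict (Ioc (-π) π)).withDensity fun θ =>
      ENNReal.ofReal (fermiPolarDOS μ θ)) := (continuous_fermiPolar hμ₁ hμ₂).measurable.aemeasurable
  rw [fermiCurveMeasure_eq_map hμ₁ hμ₂] at hf
  have h := hf.comp_aemeasurable hFm
  -- `w dθ` and `dθ` have the same null sets on `(-π, π]`
  refine h.mono_ac ?_
  refine withDensity_absolutelyContinuous' ?_ ?_
  · exact (ENNReal.measurable_ofReal.comp (continuous_fermiPolarDOS hμ₁ hμ₂).measurable).aemeasurable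
  · exact Filter.Eventually.of_forall fun θ => (ENNReal.ofReal_pos.2 (fermiPolarDOS_pos hμ₁ hμ₂ θ)).ne'

end Integral

end Literature.MathematicalPhysics.QuantumLattice

end
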